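import Summits.Ventures.HodgeRepro2.T6N3Decomp

/-!
# T6N3Iso — the assembly N3.L8 in kernel: both sides ⟹ a single pair of products pairs non-trivially

Cell pub-hodge-repro2, Tier 6 (README §10), seat t6-p3 (N3 owner, M2). Record: TIER5 §N3.4, N3.L8
(«ASSEMBLY: both sides ⟹ (N)»), steps (3)–(4), over the datum `N3Datum` (T6N3Datum), the decomposition
of T6N3Decomp and the interface Props of T6N3Interface as binders.

THE ISOTYPIC DECOMPOSITION (N3.L8 (3), «one paragraph [A]»): a `ρ`-stable subspace `M ⊆ 𝒱` containing an
element with a non-zero `σ_{i₀}`-component contains `σ_{i₀}` — by induction on the support of the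
decomposition, with Schur's lemma in the form `AutNonIso` for the reduction step (`exists_comp_k_eq_zero`:
on the `G(𝔸_f)`-span of `x`, `comp i₀` factors through `comp k` unless some vector kills the `k`-component
but not the `i₀`-component) and `AutSimple` at the end. THE CONCLUSION (N3.L8 (4)): if `ℓ_A^σ ≢ 0` and
`ℓ_B^σ ≢ 0` on `σ^τ` for the same `σ`, then `σ_f ⊆ M_A ∩ M_B` and a non-zero `x ∈ σ_f`, written as a finite
sum of single products on both sides, has `0 ≠ ⟨x, x⟩ = Σ_{i,j} ⟨η_aη_b, η_cη_d⟩`, so some single pair pairs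
non-trivially (`exists_pairing_ne_zero`).

§8(d): uses an L-value-free non-vanishing device: NO.
-/

namespace Summit.Ventures.HodgeRepro2.T6.N3Datum

open scoped InnerProductSpace

variable (𝒟 : N3Datum)

/-! ## 3. (continued) Component kernels, the Schur factorisation, the reduction step -/

/-- The vectors of a subspace `N ⊆ 𝒱` whose `k`-th component vanishes. -/
def compKer (hO : 𝒟.AutOrthogonal) (k : 𝒟.Aut) (N : Submodule ℂ 𝒟.LG) (hN : N ≤ 𝒟.V20) :
    Submodule ℂ 𝒟.LG where
  carrier := {z | z ∈ N ∧ 𝒟.comp k z = 0}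
  zero_mem' := ⟨N.zero_mem, by
    have := 𝒟.comp_of_mem_tauPart hO (Submodule.zero_mem (𝒟.tauPart k))
    exact this.1⟩
  add_mem' := fun {a b} ha hb => ⟨N.add_mem ha.1 hb.1, by
    rw [𝒟.comp_add hO (hN ha.1) (hN hb.1), ha.2, hb.2, add_zero]⟩
  smul_mem' := fun c {a} ha => ⟨N.smul_mem c ha.1, by
    rw [𝒟.comp_smul hO (hN ha.1), ha.2, smul_zero]⟩

/-- Membership in `compKer`. -/
lemma mem_compKer (hO : 𝒟.AutOrthogonal) {k : 𝒟.Aut} {N : Submodule ℂ 𝒟.LG} {hN : N ≤ 𝒟.V20}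
    {z : 𝒟.LG} : z ∈ 𝒟.compKer hO k N hN ↔ z ∈ N ∧ 𝒟.comp k z = 0 :=
  Iff.rfl

/-- `compKer` is stable for a stable `N` (equivariance of the components). -/
lemma isStable_compKer (hO : 𝒟.AutOrthogonal) (hst : 𝒟.AutStable) (k : 𝒟.Aut)
    {N : Submodule ℂ 𝒟.LG} (hN : N ≤ 𝒟.V20) (hNst : 𝒟.IsStable N) :
    𝒟.IsStable (𝒟.compKer hO k N hN) := by
  intro g z hz
  refine ⟨hNst g z hz.1, ?_⟩
  rw [𝒟.comp_rho hO hst (hN hz.1), hz.2, map_zero]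

/-- Components vanishing on `x` vanish on the `G(𝔸_f)`-span of `x`. -/
lemma comp_eq_zero_of_mem_rhoSpan (hO : 𝒟.AutOrthogonal) (hst : 𝒟.AutStable) {x : 𝒟.LG}
    (hx : x ∈ 𝒟.V20) {k : 𝒟.Aut} (hk : 𝒟.comp k x = 0) {z : 𝒟.LG} (hz : z ∈ 𝒟.rhoSpan x) :
    𝒟.comp k z = 0 :=
  (𝒟.rhoSpan_le (N := 𝒟.compKer hO k 𝒟.V20 le_rfl) ⟨hx, hk⟩
    (𝒟.isStable_compKer hO hst k le_rfl (𝒟.isStable_V20 hst)) hz).2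

/-- The `k`-th component as a linear map on a subspace `N ⊆ 𝒱`, landing in `σ′_k`. -/
noncomputable def compLin (hO : 𝒟.AutOrthogonal) (k : 𝒟.Aut) (N : Submodule ℂ 𝒟.LG)
    (hN : N ≤ 𝒟.V20) : N →ₗ[ℂ] 𝒟.tauPart k where
  toFun z := ⟨𝒟.comp k z, 𝒟.comp_mem (hN z.2) k⟩
  map_add' a b := by
    apply Subtype.ext
    simp only [Submodule.coe_add]
    exact 𝒟.comp_add hO (hN a.2) (hN b.2) k
  map_smul' c a := by
    apply Subtype.ext
    simp only [Submodule.coe_smul, RingHom.id_apply]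
    exact 𝒟.comp_smul hO (hN a.2) c k

/-- `compLin` evaluates as the component. -/
lemma compLin_apply (hO : 𝒟.AutOrthogonal) (k : 𝒟.Aut) (N : Submodule ℂ 𝒟.LG) (hN : N ≤ 𝒟.V20)
    (z : N) : (𝒟.compLin hO k N hN z : 𝒟.LG) = 𝒟.comp k z := rfl

/-- The factorisation of `comp i₀` through `comp k` on a subspace on which `ker (comp k) ⊆ ker (comp i₀)`
and `comp k` is onto `σ′_k`: the linear map `Φ : σ′_k → σ′_{i₀}` with `Φ (comp k z) = comp i₀ z`. -/
noncomputable def factor (hO : 𝒟.AutOrthogonal) (k i₀ : 𝒟.Aut) (N : Submodule ℂ 𝒟.LG)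
    (hN : N ≤ 𝒟.V20) (hs : Function.Surjective (𝒟.compLin hO k N hN))
    (hker : ∀ z : N, 𝒟.compLin hO k N hN z = 0 → 𝒟.compLin hO i₀ N hN z = 0) :
    𝒟.tauPart k →ₗ[ℂ] 𝒟.tauPart i₀ where
  toFun w := 𝒟.compLin hO i₀ N hN (Classical.choose (hs w))
  map_add' w₁ w₂ := by
    have h1 := Classical.choose_spec (hs w₁)
    have h2 := Classical.choose_spec (hs w₂)
    have h12 := Classical.choose_spec (hs (w₁ + w₂))
    have h0 : 𝒟.compLin hO k N hN
        (Classical.choose (hs (w₁ + w₂)) - (Classical.choose (hs w₁) + Classical.choose (hs w₂))) = 0 := by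
      rw [map_sub, map_add, h12, h1, h2, sub_self]
    have := hker _ h0
    rw [map_sub, map_add, sub_eq_zero] at this
    exact this
  map_smul' c w := by
    have h1 := Classical.choose_spec (hs w)
    have hc := Classical.choose_spec (hs (c • w))
    have h0 : 𝒟.compLin hO k N hN (Classical.choose (hs (c • w)) - c • Classical.choose (hs w)) = 0 := by
      rw [map_sub, map_smul, hc, h1, sub_self]
    have := hker _ h0
    rw [map_sub, map_smul, sub_eq_zero] at this
    exact this

/-- `Φ (comp k z) = comp i₀ z`: the defining property of the factorisation. -/
lemma factor_apply_compLin (hO : 𝒟.AutOrthogonal) (k i₀ : 𝒟.Aut) (N : Submodule ℂ 𝒟.LG)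
    (hN : N ≤ 𝒟.V20) (hs : Function.Surjective (𝒟.compLin hO k N hN))
    (hker : ∀ z : N, 𝒟.compLin hO k N hN z = 0 → 𝒟.compLin hO i₀ N hN z = 0) (z : N) :
    𝒟.factor hO k i₀ N hN hs hker (𝒟.compLin hO k N hN z) = 𝒟.compLin hO i₀ N hN z := by
  have h1 := Classical.choose_spec (hs (𝒟.compLin hO k N hN z))
  have h0 : 𝒟.compLin hO k N hN (Classical.choose (hs (𝒟.compLin hO k N hN z)) - z) = 0 := by
    rw [map_sub, h1, sub_self]
  have := hker _ h0
  rw [map_sub, sub_eq_zero] at this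
  exact this

/-- THE REDUCTION STEP of the isotypic decomposition: on a stable `N ⊆ 𝒱` containing `x` with
`comp i₀ x ≠ 0` and `comp k x ≠ 0` (`k ≠ i₀`), some `z ∈ N` has `comp k z = 0` and `comp i₀ z ≠ 0`
(else `comp i₀` would factor through `comp k` as a non-zero equivariant map `σ′_k → σ′_{i₀}`, against
Schur's lemma / `AutNonIso`). -/
lemma exists_comp_k_eq_zero (hO : 𝒟.AutOrthogonal) (hst : 𝒟.AutStable) (hsimp : 𝒟.AutSimple)
    (hnon : 𝒟.AutNonIso hst) {k i₀ : 𝒟.Aut} (hki : k ≠ i₀) {N : Submodule ℂ 𝒟.LG}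
    (hN : N ≤ 𝒟.V20) (hNst : 𝒟.IsStable N) {x : 𝒟.LG} (hx : x ∈ N) (hxi : 𝒟.comp i₀ x ≠ 0)
    (hxk : 𝒟.comp k x ≠ 0) : ∃ z ∈ N, 𝒟.comp k z = 0 ∧ 𝒟.comp i₀ z ≠ 0 := by
  by_cases hcon : ∃ z ∈ N, 𝒟.comp k z = 0 ∧ 𝒟.comp i₀ z ≠ 0
  · exact hcon
  exfalso
  have hker : ∀ z : N, 𝒟.compLin hO k N hN z = 0 → 𝒟.compLin hO i₀ N hN z = 0 := by
    intro z hz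
    apply Subtype.ext
    rw [compLin_apply, Submodule.coe_zero]
    by_contra h
    exact hcon ⟨z, z.2, congrArg Subtype.val hz, h⟩
  -- `comp k` is onto `σ′_k`: its image is a non-zero stable subspace of `σ′_k`
  have hs : Function.Surjective (𝒟.compLin hO k N hN) := by
    set I : Submodule ℂ 𝒟.LG :=
      Submodule.map (𝒟.tauPart k).subtype (LinearMap.range (𝒟.compLin hO k N hN)) with hI
    have hIle : I ≤ 𝒟.tauPart k := by
      rintro _ ⟨w, _, rfl⟩
      exact w.2
    have hIst : 𝒟.IsStable I := by
      rintro g _ ⟨w, ⟨z, rfl⟩, rfl⟩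
      refine ⟨𝒟.compLin hO k N hN ⟨𝒟.ρ g z, hNst g z z.2⟩, ⟨_, rfl⟩, ?_⟩
      simp only [Submodule.coe_subtype, compLin_apply]
      exact 𝒟.comp_rho hO hst (hN z.2) g k
    have hIne : I ≠ ⊥ := by
      intro hbot
      have hmem : 𝒟.comp k x ∈ I := ⟨𝒟.compLin hO k N hN ⟨x, hx⟩, ⟨_, rfl⟩, rfl⟩
      rw [hbot, Submodule.mem_bot] at hmem
      exact hxk hmem
    have hIeq : I = 𝒟.tauPart k := (hsimp k I hIle hIst).resolve_left hIne
    intro w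
    have hw : (w : 𝒟.LG) ∈ I := by
      rw [hIeq]
      exact w.2
    obtain ⟨w', ⟨z, hz⟩, hw'⟩ := hw
    refine ⟨z, ?_⟩
    apply Subtype.ext
    rw [hz]
    exact hw'
  -- the factorisation `Φ : σ′_k → σ′_{i₀}` is equivariant and non-zero
  set Φ := 𝒟.factor hO k i₀ N hN hs hker with hΦ
  have hequiv : ∀ (g : 𝒟.Gf) (w : 𝒟.tauPart k),
      (Φ ⟨𝒟.ρ g w, hst k g w w.2⟩ : 𝒟.LG) = 𝒟.ρ g (Φ w) := by
    intro g w
    obtain ⟨z, hz⟩ := hs w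
    have hw' : (⟨𝒟.ρ g w, hst k g w w.2⟩ : 𝒟.tauPart k) =
        𝒟.compLin hO k N hN ⟨𝒟.ρ g z, hNst g z z.2⟩ := by
      apply Subtype.ext
      show 𝒟.ρ g (w : 𝒟.LG) = 𝒟.comp k (𝒟.ρ g z)
      rw [← hz, compLin_apply]
      exact (𝒟.comp_rho hO hst (hN z.2) g k).symm
    rw [hw', ← hz, hΦ, 𝒟.factor_apply_compLin, 𝒟.factor_apply_compLin, compLin_apply, compLin_apply]
    exact 𝒟.comp_rho hO hst (hN z.2) g i₀
  have hΦ0 : Φ = 0 := hnon k i₀ hki Φ hequiv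
  have hx' : Φ (𝒟.compLin hO k N hN ⟨x, hx⟩) = 𝒟.compLin hO i₀ N hN ⟨x, hx⟩ :=
    𝒟.factor_apply_compLin hO k i₀ N hN hs hker ⟨x, hx⟩
  rw [hΦ0, LinearMap.zero_apply] at hx'
  apply hxi
  have := congrArg Subtype.val hx'
  rw [compLin_apply, Submodule.coe_zero] at this
  exact this.symm

/-- THE ISOTYPIC DECOMPOSITION (N3.L8 (3), «a `G(𝔸_f)`-submodule `M` of an algebraic direct sum of pairwise
non-isomorphic irreducible smooth modules satisfies `M = ⊕ (M ∩ σ′_f)`», in the form used: a stable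
subspace `M ⊆ 𝒱` containing an element with a non-zero `σ′_{i₀}`-component contains `σ′_{i₀}`. By
induction on the support of the decomposition; the reduction step is `exists_comp_k_eq_zero`
(Schur), the last step is the simplicity of `σ′_{i₀}`. -/
theorem tauPart_le_of_comp_ne_zero (hO : 𝒟.AutOrthogonal) (hst : 𝒟.AutStable)
    (hsimp : 𝒟.AutSimple) (hnon : 𝒟.AutNonIso hst) (i₀ : 𝒟.Aut) {M : Submodule ℂ 𝒟.LG}
    (hM : M ≤ 𝒟.V20) (hMst : 𝒟.IsStable M) {x : 𝒟.LG} (hx : x ∈ M) (hxi : 𝒟.comp i₀ x ≠ 0) :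
    𝒟.tauPart i₀ ≤ M := by
  classical
  suffices H : ∀ n : ℕ, ∀ x : 𝒟.LG, x ∈ M → 𝒟.comp i₀ x ≠ 0 →
      (𝒟.decomp x).support.card = n → 𝒟.tauPart i₀ ≤ M from H _ x hx hxi rfl
  intro n
  induction n using Nat.strong_induction_on with
  | _ n ih =>
  intro x hx hxi hn
  by_cases hk : ∃ k ∈ (𝒟.decomp x).support, k ≠ i₀
  · obtain ⟨k, hkmem, hki⟩ := hk
    have hxk : 𝒟.comp k x ≠ 0 := 𝒟.mem_support_iff_comp_ne_zero.mp hkmem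
    have hNle : 𝒟.rhoSpan x ≤ M := 𝒟.rhoSpan_le hx hMst
    have hNV : 𝒟.rhoSpan x ≤ 𝒟.V20 := hNle.trans hM
    obtain ⟨z, hzN, hzk, hzi⟩ := 𝒟.exists_comp_k_eq_zero hO hst hsimp hnon hki hNV
      (𝒟.isStable_rhoSpan x) (𝒟.mem_rhoSpan x) hxi hxk
    have hsub : (𝒟.decomp z).support ⊆ (𝒟.decomp x).support.erase k := by
      intro j hj
      rw [Finset.mem_erase]
      refine ⟨?_, ?_⟩
      · rintro rfl
        exact (𝒟.mem_support_iff_comp_ne_zero.mp hj) hzk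
      · by_contra hjx
        have h0 : 𝒟.comp j x = 0 := 𝒟.comp_eq_zero_of_notMem_support hjx
        exact (𝒟.mem_support_iff_comp_ne_zero.mp hj)
          (𝒟.comp_eq_zero_of_mem_rhoSpan hO hst (hM hx) h0 hzN)
    have hlt : (𝒟.decomp z).support.card < n := by
      rw [← hn]
      exact lt_of_le_of_lt (Finset.card_le_card hsub)
        (Finset.card_lt_card (Finset.erase_ssubset hkmem))
    exact ih _ hlt z (hNle hzN) hzi rfl
  · have hall : ∀ k ∈ (𝒟.decomp x).support, k = i₀ := fun k hk' => by
      by_contra h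
      exact hk ⟨k, hk', h⟩
    have hxV : x ∈ 𝒟.V20 := hM hx
    have hxσ : x ∈ 𝒟.tauPart i₀ := by
      rw [← 𝒟.sum_comp hxV]
      refine Submodule.sum_mem _ fun j hj => ?_
      rw [hall j hj]
      exact 𝒟.comp_mem hxV i₀
    have hx0 : x ≠ 0 := fun h => hxi (by
      rw [h]
      exact (𝒟.comp_of_mem_tauPart hO (Submodule.zero_mem (𝒟.tauPart i₀))).1)
    have hNle : 𝒟.rhoSpan x ≤ 𝒟.tauPart i₀ := 𝒟.rhoSpan_le hxσ (𝒟.isStable_tauPart hst i₀)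
    have hNeq : 𝒟.rhoSpan x = 𝒟.tauPart i₀ :=
      (hsimp i₀ _ hNle (𝒟.isStable_rhoSpan x)).resolve_left (𝒟.rhoSpan_ne_bot hx0)
    rw [← hNeq]
    exact 𝒟.rhoSpan_le hx hMst

/-! ## 4. The conclusion (N3.L8 (4)) -/

/-- `M_A` is `G(𝔸_f)`-stable (N3.L8 (2)). -/
lemma isStable_productModule (X : N3Side 𝒟.LG 𝒟.Gf) (hPeq : 𝒟.ProductEquivariant X) :
    𝒟.IsStable (𝒟.productModule X) := by
  intro g y hy
  refine Submodule.span_induction (p := fun y _ => 𝒟.ρ g y ∈ 𝒟.productModule X) ?_ ?_ ?_ ?_ hy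
  · rintro _ ⟨⟨φa, φb⟩, rfl⟩
    rw [hPeq g]
    exact Submodule.subset_span ⟨(X.ωGa g φa, X.ωGb g φb), rfl⟩
  · rw [map_zero]
    exact Submodule.zero_mem _
  · intro a b _ _ ha hb
    rw [map_add]
    exact Submodule.add_mem _ ha hb
  · intro c a _ ha
    rw [map_smul]
    exact Submodule.smul_mem _ c ha

/-- N3.L8 (4), first half: `ℓ^σ ≢ 0` on `σ^τ` for the side `X` with `σ = aut i₀` gives `σ_f ⊆ M_X`
(«`M_A^σ ≠ 0`, hence `M_A^σ = σ_f`»). -/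
theorem tauPart_le_productModule (hO : 𝒟.AutOrthogonal) (hst : 𝒟.AutStable)
    (hsimp : 𝒟.AutSimple) (hnon : 𝒟.AutNonIso hst) (X : N3Side 𝒟.LG 𝒟.Gf)
    (hP : 𝒟.ProductsIn20 X) (hPeq : 𝒟.ProductEquivariant X) {i₀ : 𝒟.Aut}
    (hi₀ : 𝒟.aut i₀ = X.σ) (hℓ : 𝒟.ellNonzero X) : 𝒟.tauPart i₀ ≤ 𝒟.productModule X := by
  obtain ⟨φa, φb, ψ, hψ, hne⟩ := hℓ
  have hx : X.F φa φb ∈ 𝒟.productModule X := Submodule.subset_span ⟨(φa, φb), rfl⟩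
  have hxV : X.F φa φb ∈ 𝒟.V20 := hP hx
  have hψσ : ψ ∈ 𝒟.tauPart i₀ := ⟨by rw [hi₀]; exact hψ.1, hψ.2⟩
  have hcomp : 𝒟.comp i₀ (X.F φa φb) ≠ 0 := by
    intro h0
    apply hne
    show ⟪ψ, X.F φa φb⟫_ℂ = 0
    rw [← 𝒟.sum_comp hxV, inner_sum]
    refine Finset.sum_eq_zero fun j _ => ?_
    by_cases hji : j = i₀
    · rw [hji, h0, inner_zero_right]
    · exact hO i₀ j (Ne.symm hji) ψ hψσ.1 _ (𝒟.comp_mem hxV j).1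
  exact 𝒟.tauPart_le_of_comp_ne_zero hO hst hsimp hnon i₀ hP
    (𝒟.isStable_productModule X hPeq) hx hcomp

/-- N3.L8 (ASSEMBLY): «both sides ⟹ some single pair of products pairs non-trivially». If `ℓ_A^σ ≢ 0`
and `ℓ_B^σ ≢ 0` on `σ^τ` for the SAME `σ` (a τ-type automorphic subrepresentation), then there are
single products `F_A(φ_a, φ_b)`, `F_B(φ_c, φ_d)` with `⟨F_A, F_B⟩_{L²([G])} ≠ 0` — in Mathlib's convention
`⟪F_B, F_A⟫_ℂ ≠ 0`. -/
theorem exists_pairing_ne_zero (hO : 𝒟.AutOrthogonal) (hst : 𝒟.AutStable) (hsimp : 𝒟.AutSimple)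
    (hnon : 𝒟.AutNonIso hst) (X Y : N3Side 𝒟.LG 𝒟.Gf) (hPX : 𝒟.ProductsIn20 X)
    (hPeqX : 𝒟.ProductEquivariant X) (hPY : 𝒟.ProductsIn20 Y) (hPeqY : 𝒟.ProductEquivariant Y)
    (hσX : 𝒟.SigmaIsAut X) (hσ : Y.σ = X.σ) (hA : 𝒟.ellNonzero X) (hB : 𝒟.ellNonzero Y) :
    ∃ (φa : X.Sa) (φb : X.Sb) (φc : Y.Sa) (φd : Y.Sb), ⟪Y.F φc φd, X.F φa φb⟫_ℂ ≠ 0 := by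
  obtain ⟨i₀, hi₀⟩ := hσX
  have hA' := 𝒟.tauPart_le_productModule hO hst hsimp hnon X hPX hPeqX hi₀ hA
  have hB' := 𝒟.tauPart_le_productModule hO hst hsimp hnon Y hPY hPeqY (hi₀.trans hσ.symm) hB
  obtain ⟨φa, φb, ψ, hψ, hne⟩ := hA
  have hψσ : ψ ∈ 𝒟.tauPart i₀ := ⟨by rw [hi₀]; exact hψ.1, hψ.2⟩
  have hψ0 : ψ ≠ 0 := fun h => hne (by
    show ⟪ψ, X.F φa φb⟫_ℂ = 0
    rw [h, inner_zero_left])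
  obtain ⟨n, a, p, hp⟩ := Submodule.mem_span_set'.mp (hA' hψσ)
  obtain ⟨m, b, q, hq⟩ := Submodule.mem_span_set'.mp (hB' hψσ)
  choose pa hpa using fun i => (p i).2
  choose qb hqb using fun j => (q j).2
  have hpa' : ∀ i, ((p i : 𝒟.LG)) = X.F (pa i).1 (pa i).2 := fun i => by
    have h := hpa i
    simp only at h
    exact h.symm
  have hqb' : ∀ j, ((q j : 𝒟.LG)) = Y.F (qb j).1 (qb j).2 := fun j => by
    have h := hqb j
    simp only at h
    exact h.symm
  by_contra hcon
  have hall : ∀ (φa : X.Sa) (φb : X.Sb) (φc : Y.Sa) (φd : Y.Sb),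
      ⟪Y.F φc φd, X.F φa φb⟫_ℂ = 0 := fun φa φb φc φd => by
    by_contra h
    exact hcon ⟨φa, φb, φc, φd, h⟩
  apply (inner_self_ne_zero (𝕜 := ℂ)).mpr hψ0
  have key : ⟪ψ, ψ⟫_ℂ = ⟪∑ j, b j • (q j : 𝒟.LG), ∑ i, a i • (p i : 𝒟.LG)⟫_ℂ := by
    rw [hq, hp]
  rw [key, sum_inner]
  refine Finset.sum_eq_zero fun j _ => ?_
  rw [inner_smul_left, inner_sum]
  refine mul_eq_zero_of_right _ (Finset.sum_eq_zero fun i _ => ?_)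
  rw [inner_smul_right, hpa' i, hqb' j, hall, mul_zero]

end Summit.Ventures.HodgeRepro2.T6.N3Datum
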